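import Summits.ResolutionOfSingularities.ResolutionOfSingularities.Theses.PAlteration
import Summits.ResolutionOfSingularities.ResolutionOfSingularities.Theorems.PAlterationPialtSplitIndetGlue
import Summits.ResolutionOfSingularities.ResolutionOfSingularities.Theorems.PAlterationPialtEmbeddedGlue
import Literature.AlgebraicGeometry.Resolution.StrictNormalCrossings
import Literature.AlgebraicGeometry.Motives.VarietiesProperProofs
import HarnessLib

/-!
# Skeleton `IndeterminacySplitEmbedded` (line IndeterminacySplit with its second atom RE-LINED
# under the embedded parent) for crux stmt-ResolutionOfSingularities-0555 `Pialt`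

Line lead c3 (prover-line-stmt-ResolutionOfSingularities-0555-c3-0, 2026-08-17).

`Pialt` = Abramovich–Oort in characteristic `p`. The strategist's exact cut
(`Cruxes/Pialt/Lines/IndeterminacySplit.lean`, lead c2 drove its known stubs):
`Pialt ⇔ FrobIndet ∧ HypersurfacePialt` over perfect fields, glue LANDED by name
(`IndeterminacySplit.pialt_of_frobIndet_hypersurfacePialt`, `Theorems/PAlterationPialtSplitIndetGlue.lean`,
p139885). Both remaining stubs are open from dimension 4 — and PROVABLE in dimension `≤ 3`
modulo `CossartPiltant2019` exactly as registered (`OpenRange.frobIndet_of_dim_le_three`,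
`OpenRange.hypersurfacePialt_of_le_three`, this seat, p141509 / p141077).

THIS RESHAPE replaces the structureless atom `stub_hypersurfacePialt` ("the crux for hypersurfaces
of `ℙⁿ⁺¹`") by its EMBEDDED PARENT recommended by the census (`STRATEGY-CENSUS.md` (S5)):

* `stub_piEmbeddedResolution` — **purely inseparable EMBEDDED resolution of hypersurface pairs
  `(ℙⁿ⁺¹_k, H)`**: a proper surjective `g : P' → ℙⁿ⁺¹_k` with `P'` integral and REGULAR, finite
  and universally injective over an open MEETING `H` (so `g` is a purely inseparable alteration
  of the regular ambient space which does not blow up the generic point of `H`), such that the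
  total transform `g⁻¹(H)` is a strict normal crossings divisor of `P'` (de Jong 1996, 2.4).
  This is de Jong's Thm. 4.1 (ii) for the pair `(ℙⁿ⁺¹, H)` with "alteration" sharpened to
  "purely inseparable alteration"; in characteristic zero it is Hironaka's embedded resolution;
  it is KNOWN for `n ≤ 2` (embedded resolution of curves in surfaces / surfaces in threefolds,
  by birational `g`) and OPEN from `n = 3` (embedded resolution of threefolds in `ℙ⁴`). Unlike
  the atom it replaces, it carries the classical inductive structure (regular ambient space,
  boundary divisor, order of `H` along strata) that every known resolution method runs on.
  The glue `EmbeddedGlue.hypersurfacePialt_of_piEmbeddedResolution` (LANDED, this seat): the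
  closure of the unique point of `P'` over the generic point of `H` is a component of the strict
  normal crossings divisor `g⁻¹(H)`, hence regular, and maps onto `H` properly, finitely and
  radicially over the open.
* `stub_frobIndet` — unchanged (verbatim the registered stub): purely inseparable elimination
  of indeterminacy on regular proper varieties over a perfect field; holds whenever the closure
  of the graph has a resolution (`OpenRange.frobIndetAt_of_forall_hasResolution`, LANDED).

Composition `Pialt_of`: the landed split glue applied to `stub_frobIndet` and to
`HypersurfacePialt` derived from `stub_piEmbeddedResolution`. Sorries only in the two stubs.
Exactness: `Pialt ⇒ FrobIndet` is landed (`stub_frobIndet_of_pialtOver`); `Pialt ⇒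
PiEmbeddedResolution` is NOT claimed (the embedded parent is a priori stronger than the crux at
`H` — that is the price of the inductive structure).
-/

set_option linter.dupNamespace false

noncomputable section

open CategoryTheory CategoryTheory.Limits AlgebraicGeometry TopologicalSpace
open Literature.AlgebraicGeometry.Resolution
open Summit.ResolutionOfSingularities.ResolutionOfSingularities.Theses.PAlteration (Pialt)

namespace Summit.ResolutionOfSingularities.ResolutionOfSingularities.Theorems.Pialt.IndeterminacySplitEmbedded

/-! ## Stubs -/

/-- STUB (OPEN from dimension 4; unchanged from line IndeterminacySplit): **`FrobIndet` — purely
inseparable elimination of indeterminacy on regular proper varieties over a perfect field.**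
Holds whenever the closure of the graph has a resolution of singularities
(`OpenRange.frobIndetAt_of_forall_hasResolution`), hence in dimension `≤ 3` modulo
`CossartPiltant2019` and in general modulo `ResolutionInChar p`. -/
theorem stub_frobIndet (p : ℕ) (hp : p.Prime) (k : Type) [Field k] [CharP k p] [PerfectField k]
    (Y X₁ : Scheme.{0}) (fY : Y ⟶ Spec (.of k)) (f₁ : X₁ ⟶ Spec (.of k)) [IsProper fY]
    [IsProper f₁] [IsIntegral Y] (hY : Scheme.IsRegular Y) [IsIntegral X₁] (V : Y.Opens)
    (φ : (V : Scheme.{0}) ⟶ X₁) (hV : (V : Set Y).Nonempty) (hφ : V.ι ≫ fY = φ ≫ f₁) :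
    ∃ (Y' : Scheme.{0}) (g : Y' ⟶ Y) (ψ : Y' ⟶ X₁), IsProper g ∧ IsIntegral Y' ∧
      Scheme.IsRegular Y' ∧ Function.Surjective g.base ∧
      (∃ V' : Y.Opens, Dense (V' : Set Y) ∧ IsFinite (g ∣_ V') ∧
        UniversallyInjective (g ∣_ V')) ∧
      ψ ≫ f₁ = g ≫ fY ∧ (g ⁻¹ᵁ V).ι ≫ ψ = (g ∣_ V) ≫ φ := by
  sorry

/-- STUB (OPEN from `n = 3`; the EMBEDDED PARENT of `stub_hypersurfacePialt`): **purely
inseparable embedded resolution of hypersurface pairs `(ℙⁿ⁺¹_k, H)` over a perfect field** —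
for an integral closed `H ⊆ ℙⁿ⁺¹_k` of dimension `n` there are a proper surjective
`g : P' → ℙⁿ⁺¹_k` with `P'` integral regular, finite and universally injective over an open of
`ℙⁿ⁺¹_k` meeting `H`, such that `g⁻¹(H)` is a strict normal crossings divisor of `P'`
(de Jong 1996, 2.4; Thm. 4.1 (ii) with "alteration" sharpened to "purely inseparable alteration of
the regular ambient space"). Known for `n ≤ 2` by birational `g` (embedded resolution of curves
in surfaces and of surfaces in threefolds); open from `n = 3`. -/
theorem stub_piEmbeddedResolution (p : ℕ) (hp : p.Prime) (k : Type) [Field k] [CharP k p]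
    [PerfectField k] (n : ℕ) (H : Scheme.{0})
    (ι : H ⟶ (Literature.AlgebraicGeometry.Motives.projectiveSpace (n + 1) k).left)
    [IsClosedImmersion ι] [IsIntegral H] (hdim : topologicalKrullDim H = (n : WithBot ℕ∞)) :
    ∃ (P' : Scheme.{0})
      (g : P' ⟶ (Literature.AlgebraicGeometry.Motives.projectiveSpace (n + 1) k).left),
      IsProper g ∧ IsIntegral P' ∧ Scheme.IsRegular P' ∧ Function.Surjective g.base ∧
      (∃ U : (Literature.AlgebraicGeometry.Motives.projectiveSpace (n + 1) k).left.Opens,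
        ((U : Set _) ∩ Set.range ι.base).Nonempty ∧ IsFinite (g ∣_ U) ∧
          UniversallyInjective (g ∣_ U)) ∧
      IsStrictNormalCrossingsDivisor P' (g.base ⁻¹' Set.range ι.base) := by
  sorry

/-! ## The second half of the cut, from the embedded parent (glue LANDED) -/

/-- `HypersurfacePialt` (the registered atom `stub_hypersurfacePialt`, signature verbatim) from the
embedded parent, by `EmbeddedGlue.hypersurfacePialt_of_piEmbeddedResolution`. -/
theorem hypersurfacePialt_of_stub (p : ℕ) (hp : p.Prime) (k : Type) [Field k] [CharP k p]
    [PerfectField k] (n : ℕ) (H : Scheme.{0})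
    (ι : H ⟶ (Literature.AlgebraicGeometry.Motives.projectiveSpace (n + 1) k).left)
    [IsClosedImmersion ι] [IsIntegral H] (hdim : topologicalKrullDim H = (n : WithBot ℕ∞)) :
    ∃ (H' : Scheme.{0}) (g : H' ⟶ H), IsProper g ∧ IsIntegral H' ∧ Scheme.IsRegular H' ∧
      Function.Surjective g.base ∧ ∃ U : H.Opens, Dense (U : Set H) ∧ IsFinite (g ∣_ U) ∧
        UniversallyInjective (g ∣_ U) :=
  EmbeddedGlue.hypersurfacePialt_of_piEmbeddedResolution p hp k n H ι hdim
    (stub_piEmbeddedResolution p hp k n H ι hdim)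

/-! ## Composition -/

/-- COMPOSITION: the crux BY NAME from the two stubs, through the landed exact-split glue
`IndeterminacySplit.pialt_of_frobIndet_hypersurfacePialt` (perfect fields suffice; normal proper
`X`; hypersurface model; birational seam). Sorries only inside `stub_*`. -/
theorem Pialt_of : Pialt :=
  IndeterminacySplit.pialt_of_frobIndet_hypersurfacePialt
    (fun p hp k _ _ _ Y X₁ fY f₁ hfY hf₁ hY hYreg hX₁ V φ hV hφ => by
      haveI := hfY; haveI := hf₁; haveI := hY; haveI := hX₁
      exact stub_frobIndet p hp k Y X₁ fY f₁ hYreg V φ hV hφ)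
    (fun p hp k _ _ _ n H ι hι hH hdim => by
      haveI := hι; haveI := hH
      exact hypersurfacePialt_of_stub p hp k n H ι hdim)

end Summit.ResolutionOfSingularities.ResolutionOfSingularities.Theorems.Pialt.IndeterminacySplitEmbedded

end
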